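import Mathlib
import Literature.MathematicalPhysics.QuantumManyBody.BoseEinsteinCondensation
import Summits.AtomisticToContinuum.BoseEinsteinCondensation.Theorems.SoloBlindBhattacharyya
import Summits.AtomisticToContinuum.BoseEinsteinCondensation.Theorems.SoloBlindTrialStateCriterion
import Summits.AtomisticToContinuum.BoseEinsteinCondensation.Theorems.SoloBlindMutualInformation

/-!
# The marginals of the Born law and the canonical form `KL(𝐏 ‖ 𝐏.fst ⊗ 𝐏.snd)`

Solo seat `solo-AtomisticToContinuum-blind`, conjunct `BoseEinsteinCondensation`.  The two
marginal measures of the Born law `𝐏 = Φ(x :: Y)² d(x, Y)` are the measures with the Tonelli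
densities `ρ₁(x) = ∫ Φ(x :: Y)² dY` and `P̂(Y) = ∫ Φ(x :: Y)² dx` (`fst_born_eq`, `snd_born_eq`), so the
mutual-information criterion of `SoloBlindMutualInformation` takes its canonical form: with
`I(x₁ ; X̂) := KL(𝐏 ‖ 𝐏.fst ⊗ 𝐏.snd)` (Mathlib's `Measure.fst`, `Measure.snd`, `klDiv`),
`I(x₁ ; X̂) ≤ K ⇒ (n+1) · e^{−K} ≤ maxOccupation (n+1) Φ`
(`mul_exp_neg_le_maxOccupation_of_klDiv_fst_prod_snd_le`, and its `TrialState` form).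
-/

open MeasureTheory InformationTheory
open scoped ENNReal

namespace Summit.AtomisticToContinuum.BoseEinsteinCondensation.Theorems

open Literature.MathematicalPhysics.QuantumManyBody.BoseGas

/-- First marginal of the Born law: the one-particle density `ρ₁(x) = ∫ Φ(x :: Y)² dY`. -/
theorem fst_born_eq {n : ℕ} {Φ : Config (n + 1) → ℝ} (hΦm : Measurable Φ) :
    (((volume : Measure Space).prod (volume : Measure (Config n))).withDensity
        fun z => ENNReal.ofReal (Φ (Matrix.vecCons z.1 z.2)) ^ 2).fst =
      (volume : Measure Space).withDensity
        fun x => ∫⁻ Y : Config n, ENNReal.ofReal (Φ (Matrix.vecCons x Y)) ^ 2 := by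
  have hpm : Measurable fun z : Space × Config n =>
      ENNReal.ofReal (Φ (Matrix.vecCons z.1 z.2)) ^ 2 :=
    ((hΦm.comp measurable_vecCons).ennreal_ofReal).pow_const 2
  ext s hs
  rw [Measure.fst_apply hs, withDensity_apply _ (measurable_fst hs), withDensity_apply _ hs,
    ← Set.prod_univ, ← Measure.prod_restrict, Measure.restrict_univ,
    lintegral_prod _ hpm.aemeasurable]

/-- Second marginal of the Born law: the density `P̂(Y) = ∫ Φ(x :: Y)² dx` of the other particles. -/
theorem snd_born_eq {n : ℕ} {Φ : Config (n + 1) → ℝ} (hΦm : Measurable Φ) :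
    (((volume : Measure Space).prod (volume : Measure (Config n))).withDensity
        fun z => ENNReal.ofReal (Φ (Matrix.vecCons z.1 z.2)) ^ 2).snd =
      (volume : Measure (Config n)).withDensity
        fun Y => ∫⁻ x, ENNReal.ofReal (Φ (Matrix.vecCons x Y)) ^ 2 := by
  have hpm : Measurable fun z : Space × Config n =>
      ENNReal.ofReal (Φ (Matrix.vecCons z.1 z.2)) ^ 2 :=
    ((hΦm.comp measurable_vecCons).ennreal_ofReal).pow_const 2
  ext s hs
  rw [Measure.snd_apply hs, withDensity_apply _ (measurable_snd hs), withDensity_apply _ hs,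
    ← Set.univ_prod, ← Measure.prod_restrict, Measure.restrict_univ,
    lintegral_prod_symm _ hpm.aemeasurable]

/-- **Canonical mutual-information form.** `𝐏` the Born law of `Φ ≥ 0` (normalised) on
`Space × Config n`; if `KL(𝐏 ‖ 𝐏.fst ⊗ 𝐏.snd) ≤ K` — the mutual information between the first
particle and the others — then `(n+1) · e^{−K} ≤ maxOccupation (n+1) Φ`. -/
theorem mul_exp_neg_le_maxOccupation_of_klDiv_fst_prod_snd_le {n : ℕ} {Φ : Config (n + 1) → ℝ}
    (hΦ0 : 0 ≤ Φ) (hΦm : Measurable Φ)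
    (hΦ1 : ∫⁻ Y : Config n, ∫⁻ x, ENNReal.ofReal (Φ (Matrix.vecCons x Y)) ^ 2 = 1)
    {K : ℝ} (hK0 : 0 ≤ K)
    (hI : klDiv
        (((volume : Measure Space).prod (volume : Measure (Config n))).withDensity
          fun z => ENNReal.ofReal (Φ (Matrix.vecCons z.1 z.2)) ^ 2)
        ((((volume : Measure Space).prod (volume : Measure (Config n))).withDensity
            fun z => ENNReal.ofReal (Φ (Matrix.vecCons z.1 z.2)) ^ 2).fst.prod
          (((volume : Measure Space).prod (volume : Measure (Config n))).withDensity
            fun z => ENNReal.ofReal (Φ (Matrix.vecCons z.1 z.2)) ^ 2).snd) ≤ ENNReal.ofReal K) :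
    (n + 1 : ℝ≥0∞) * ENNReal.ofReal (Real.exp (-K)) ≤
      maxOccupation (n + 1) (fun X => (Φ X : ℂ)) := by
  rw [fst_born_eq hΦm, snd_born_eq hΦm] at hI
  exact mul_exp_neg_le_maxOccupation_of_mutualInfo_le hΦ0 hΦm hΦ1 hK0 hI

namespace TrialState

/-- **Canonical mutual-information form for trial states.** For a real nonnegative
`(n+1)`-boson trial state `Ψ` (`Ψ.ψ = Φ ≥ 0`) with Born law `𝐏` in the coordinates `(x₁, X̂)`:
`KL(𝐏 ‖ 𝐏.fst ⊗ 𝐏.snd) ≤ K ⇒ (n+1) · e^{−K} ≤ maxOccupation (n+1) Ψ.ψ`. -/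
theorem mul_exp_neg_le_maxOccupation_of_klDiv_fst_prod_snd_le {n : ℕ} {L : ℝ}
    (Ψ : TrialState (n + 1) L) {Φ : Config (n + 1) → ℝ} (hΦ0 : 0 ≤ Φ)
    (hΨΦ : Ψ.ψ = fun X => (Φ X : ℂ)) {K : ℝ} (hK0 : 0 ≤ K)
    (hI : klDiv
        (((volume : Measure Space).prod (volume : Measure (Config n))).withDensity
          fun z => ENNReal.ofReal (Φ (Matrix.vecCons z.1 z.2)) ^ 2)
        ((((volume : Measure Space).prod (volume : Measure (Config n))).withDensity
            fun z => ENNReal.ofReal (Φ (Matrix.vecCons z.1 z.2)) ^ 2).fst.prod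
          (((volume : Measure Space).prod (volume : Measure (Config n))).withDensity
            fun z => ENNReal.ofReal (Φ (Matrix.vecCons z.1 z.2)) ^ 2).snd) ≤ ENNReal.ofReal K) :
    (n + 1 : ℝ≥0∞) * ENNReal.ofReal (Real.exp (-K)) ≤ maxOccupation (n + 1) Ψ.ψ := by
  rw [hΨΦ]
  exact Theorems.mul_exp_neg_le_maxOccupation_of_klDiv_fst_prod_snd_le hΦ0
    (measurable_of_eq_ofReal Ψ hΨΦ) (lintegral_lintegral_sq_eq_one Ψ hΦ0 hΨΦ) hK0 hI

end TrialState

end Summit.AtomisticToContinuum.BoseEinsteinCondensation.Theorems
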